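import Summits.ValiantsHypothesis.ValiantsHypothesis.Theses.RigidityForcesSymmetry
import Summits.ValiantsHypothesis.ValiantsHypothesis.Theorems.RigidityForcesSymmetryRigidityForcesTorus
import Literature.Computability.AlgebraicComplexity.DetReprEquivalent
import Literature.Computability.AlgebraicComplexity.LRLiftCharacter

/-!
# Route RigidityForcesSymmetry — `RankRigidityForcesTorus` (item stmt-ValiantsHypothesis-18035)

Rank-stratum rigidity forces the torus.  Let `Ã = Λ + Σ_v x_v A_v` be an affine determinantal
representation of `per_n`, `n ≥ 3`, whose `GL_m × GL_m`-orbit is open near `(Λ, A)` *inside its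
rank-profile stratum*: some neighbourhood `U` of `(Λ, A)` in coefficient space meets
`{p : det p̃ = per_n} ∩ {p : ∀ v, rank (p.2 v) ≤ rank (A v)}` only inside the orbit
`{(gΛh⁻¹, (gA_vh⁻¹)_v)}` (the hypothesis of `RankRigidMinimalRepr`).  Then `Ã` respects the
two-sided torus `x_{kl} ↦ d_k e_l x_{kl}` with exact lifts (`IsEquivariantDetRepr` for the subgroup
generated by the diagonal substitutions `diag(d_k e_l)`).

Proof: verbatim the landed `rigidityForcesTorus_proof`
(`Theorems/RigidityForcesSymmetryRigidityForcesTorus.lean`, whose pencil lemmas `rft_*` are reused):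
for `(a, b) ∈ ℂⁿ × ℂⁿ` put `γ(a,b) = diag(exp(a_k + b_l))`, `τ = exp(-(Σ a + Σ b))`,
`D = diag(τ, 1, …, 1)` and `F(a,b) = (D Λ, v ↦ exp(a_{v₁} + b_{v₂}) D A_v)`; `F` is continuous,
`F(0) = (Λ, A)`, its pencil is `D · Ã(γ(a,b)·x)` with determinant `per_n`, AND — the one new point —
every coefficient matrix `exp(a_{v₁} + b_{v₂}) D A_v = (exp(…) • D) * A_v` has rank `≤ rank A_v`
(`Matrix.rank_mul_le_right`), so `F(a,b)` stays in the rank stratum and the constrained rigidity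
applies along the path.  Hence all `γ(a,b)` with `(a,b)` near `0` lift; liftable parameters form an
additive subgroup of `ℂ²ⁿ` containing a ball, hence everything; every generator `diag(d_k e_l) ∈ GL`
is `γ(log d, log e)`; `Subgroup.closure_induction` finishes.
-/

noncomputable section

-- `Summit.ValiantsHypothesis.ValiantsHypothesis.…` is the tree's mandated single-conjunct layout (Sub = Summit).
set_option linter.dupNamespace false

namespace Summit.ValiantsHypothesis.ValiantsHypothesis.Theorems

open MvPolynomial Matrix Filter Topology
open scoped Kronecker
open Literature.Computability.AlgebraicComplexity
open Summit.ValiantsHypothesis.ValiantsHypothesis.Theses.RigidityForcesSymmetry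

/-- Rank monotonicity along the torus path: a rescaled left multiple `c • (D * A)` of a matrix `A`
has rank at most `rank A`. [folklore] -/
theorem rrft_rank_smul_mul_le {m : ℕ} (c : ℂ) (D A : Matrix (Fin m) (Fin m) ℂ) :
    (c • (D * A)).rank ≤ A.rank := by
  rw [← Matrix.smul_mul]
  exact Matrix.rank_mul_le_right _ _

/-- **`RankRigidityForcesTorus`** (item stmt-ValiantsHypothesis-18035 of route
RigidityForcesSymmetry): an affine determinantal representation `Λ + Σ x_v A_v` of `per_n`, `n ≥ 3`,
whose `GL_m × GL_m`-orbit is locally open inside its rank-profile stratum of `{det = per_n}` (as in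
`RankRigidMinimalRepr`) is equivariant with exact lifts for the two-sided torus
`x_{kl} ↦ d_k e_l x_{kl}`. [cite: LandsbergRessayre2017, §2.1; Borel1991] -/
theorem rankRigidityForcesTorus_proof : RankRigidityForcesTorus := by
  intro n hn m Λ A hdet hU
  refine ⟨⟨fun i j => rft_totalDegree_pencil_le Λ A i j, hdet⟩, ?_⟩
  obtain ⟨U, hUmem, hU⟩ := hU
  -- `m ≠ 0`: a `0 × 0` matrix has determinant `1 ≠ per_n`
  have hm : 0 < m := by
    rcases Nat.eq_zero_or_pos m with rfl | h
    · exfalso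
      refine rft_perPoly_ne_one (by omega : 1 ≤ n) ?_
      rw [← hdet, Matrix.det_isEmpty]
    · exact h
  set i₀ : Fin m := ⟨0, hm⟩ with hi₀
  -- the correcting diagonal gauge `D t = diag(t, 1, …, 1)`
  obtain ⟨D, hD⟩ : ∃ D : ℂ → Matrix (Fin m) (Fin m) ℂ,
      D = fun t => Matrix.diagonal fun i => if i = i₀ then t else 1 := ⟨_, rfl⟩
  have hDc : Continuous D := by
    rw [hD]
    refine Continuous.matrix_diagonal (continuous_pi fun i => ?_)
    by_cases h : i = i₀
    · simp only [h, if_true]; exact continuous_id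
    · simp only [h, if_false]; exact continuous_const
  have hDdet : ∀ t, (D t).det = t := by
    intro t
    simp [hD, Matrix.det_diagonal, Finset.prod_ite_eq']
  have hD1 : D 1 = 1 := by simp [hD]
  have hDne : ∀ t, t ≠ 0 → ∀ i, (fun i => if i = i₀ then t else (1 : ℂ)) i ≠ 0 := by
    intro t ht i
    by_cases h : i = i₀ <;> simp [h, ht]
  -- notation: the pencil, lifts, the torus parametrisation
  set M : Matrix (Fin m) (Fin m) (MvPolynomial (Fin n × Fin n) ℂ) :=
    Λ.map C + ∑ v, (X v : MvPolynomial (Fin n × Fin n) ℂ) • (A v).map C with hM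
  obtain ⟨Lift, hLift⟩ : ∃ Lift : GL (Fin n × Fin n) ℂ → Prop, Lift = fun γ =>
      ∃ g h : GL (Fin m) ℂ, Matrix.linSubstEntries γ M =
        (g : Matrix (Fin m) (Fin m) ℂ).map C * M * ((h⁻¹ : GL (Fin m) ℂ) : Matrix (Fin m) (Fin m) ℂ).map C :=
    ⟨_, rfl⟩
  obtain ⟨tor, htor⟩ : ∃ tor : (Fin n → ℂ) × (Fin n → ℂ) → (Fin n × Fin n → ℂ),
      tor = fun x p => Complex.exp (x.1 p.1 + x.2 p.2) := ⟨_, rfl⟩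
  obtain ⟨P, hP⟩ : ∃ P : (Fin n → ℂ) × (Fin n → ℂ) → Prop, P = fun x =>
      ∀ γ : GL (Fin n × Fin n) ℂ, (γ : Matrix (Fin n × Fin n) (Fin n × Fin n) ℂ) =
        Matrix.diagonal (tor x) → Lift γ := ⟨_, rfl⟩
  have htor_ne : ∀ x p, tor x p ≠ 0 := by
    intro x p; rw [htor]; exact Complex.exp_ne_zero _
  have htor_add : ∀ x y, tor (x + y) = fun p => tor x p * tor y p := by
    intro x y; funext p
    simp only [htor, Prod.fst_add, Prod.snd_add, Pi.add_apply, ← Complex.exp_add]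
    ring_nf
  -- (S2) liftable parameters are closed under addition
  have hP_add : ∀ x y, P x → P y → P (x + y) := by
    intro x y hx hy
    rw [hP] at hx hy ⊢
    intro γ hγ
    obtain ⟨γx, hγx⟩ := rft_exists_GL_eq_diagonal (tor x) (htor_ne x)
    obtain ⟨γy, hγy⟩ := rft_exists_GL_eq_diagonal (tor y) (htor_ne y)
    have hmul : γ = γx * γy := by
      refine Units.ext ?_
      rw [Units.val_mul, hγ, hγx, hγy, Matrix.diagonal_mul_diagonal, htor_add]
    rw [hmul, hLift]
    have h1 := hx γx hγx
    have h2 := hy γy hγy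
    rw [hLift] at h1 h2
    exact rft_lift_mul h1 h2
  -- (S1) liftable parameters contain a neighbourhood of `0`
  have hP_nhds : {x | P x} ∈ 𝓝 (0 : (Fin n → ℂ) × (Fin n → ℂ)) := by
    -- the continuous family of coefficient points
    obtain ⟨τ, hτ⟩ : ∃ τ : (Fin n → ℂ) × (Fin n → ℂ) → ℂ,
        τ = fun x => Complex.exp (-(∑ k, x.1 k + ∑ l, x.2 l)) := ⟨_, rfl⟩
    obtain ⟨F, hF⟩ : ∃ F : (Fin n → ℂ) × (Fin n → ℂ) →
        Matrix (Fin m) (Fin m) ℂ × (Fin n × Fin n → Matrix (Fin m) (Fin m) ℂ),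
        F = fun x => (D (τ x) * Λ, fun v => tor x v • (D (τ x) * A v)) := ⟨_, rfl⟩
    have hFc : Continuous F := by
      rw [hF, hτ, htor]
      fun_prop
    have hF0 : F 0 = (Λ, A) := by
      simp [hF, hτ, htor, hD1]
    have hFU : F ⁻¹' U ∈ 𝓝 (0 : (Fin n → ℂ) × (Fin n → ℂ)) :=
      hFc.continuousAt.preimage_mem_nhds (by rw [hF0]; exact hUmem)
    refine Filter.mem_of_superset hFU fun x hx => ?_
    simp only [Set.mem_setOf_eq, hP]
    intro γ hγ
    -- determinant of the pencil at `F x`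
    have hτne : τ x ≠ 0 := by rw [hτ]; exact Complex.exp_ne_zero _
    obtain ⟨Du, hDu⟩ := rft_exists_GL_eq_diagonal _ (hDne (τ x) hτne)
    have hDuD : (Du : Matrix (Fin m) (Fin m) ℂ) = D (τ x) := by rw [hDu, hD]
    have hpencilF : (F x).1.map C + ∑ v, (X v : MvPolynomial (Fin n × Fin n) ℂ) • ((F x).2 v).map C =
        (D (τ x)).map C * Matrix.linSubstEntries γ M := by
      rw [hM, rft_linSubstEntries_pencil hγ, rft_map_C_mul_pencil, hF]
      simp only [Matrix.mul_smul]
    have hchar : linSubst (Fin n × Fin n) ℂ (γ : Matrix (Fin n × Fin n) (Fin n × Fin n) ℂ)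
        (perPoly (Fin n) ℂ) = C ((∏ k, Complex.exp (x.1 k)) * ∏ l, Complex.exp (x.2 l)) *
          perPoly (Fin n) ℂ := by
      have hγ' : (γ : Matrix (Fin n × Fin n) (Fin n × Fin n) ℂ) =
          Matrix.diagonal (fun k => Complex.exp (x.1 k)) ⊗ₖ Matrix.diagonal (fun l => Complex.exp (x.2 l)) := by
        rw [hγ, Matrix.diagonal_kronecker_diagonal, htor]
        simp only [Complex.exp_add]
      rw [hγ']
      exact LRPencil.linSubst_diagonal_perPoly _ _
    have hdetF : ((F x).1.map C + ∑ v, (X v : MvPolynomial (Fin n × Fin n) ℂ) • ((F x).2 v).map C).det =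
        perPoly (Fin n) ℂ := by
      rw [hpencilF, Matrix.det_mul, det_map_C, det_linSubstEntries, hDdet, hdet, hchar, ← mul_assoc,
        ← map_mul]
      have : τ x * ((∏ k, Complex.exp (x.1 k)) * ∏ l, Complex.exp (x.2 l)) = 1 := by
        rw [hτ, ← Complex.exp_sum, ← Complex.exp_sum, ← Complex.exp_add, ← Complex.exp_add,
          neg_add_cancel, Complex.exp_zero]
      rw [this, C_1, one_mul]
    -- the path stays in the rank-profile stratum of `(Λ, A)`
    have hrankF : ∀ v, ((F x).2 v).rank ≤ (A v).rank := by
      intro v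
      rw [hF]
      exact rrft_rank_smul_mul_le (tor x v) (D (τ x)) (A v)
    obtain ⟨g, h, h1, h2⟩ := hU (F x) hx hdetF hrankF
    rw [hF] at h1 h2
    simp only at h1 h2
    rw [hLift]
    rw [← hDuD] at h1 h2
    exact rft_lift_of_gauge hγ Λ A Du g h h1 h2
  -- (S3) hence every parameter is liftable
  have hP_all : ∀ x, P x := by
    intro x
    have ht : Tendsto (fun N : ℕ => ((N : ℂ))⁻¹ • x) atTop (𝓝 0) := by
      have h := (tendsto_inv_atTop_nhds_zero_nat (𝕜 := ℂ)).smul_const x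
      rwa [zero_smul] at h
    obtain ⟨N, hN, hN1⟩ := ((ht.eventually_mem hP_nhds).and (eventually_ge_atTop 1)).exists
    simp only [Set.mem_setOf_eq] at hN
    have hiter : ∀ k : ℕ, 1 ≤ k → P ((k : ℂ) • ((N : ℂ)⁻¹ • x)) := by
      intro k hk
      induction k, hk using Nat.le_induction with
      | base => simpa using hN
      | succ k _ ih =>
        have : ((k + 1 : ℕ) : ℂ) • ((N : ℂ)⁻¹ • x) = (k : ℂ) • ((N : ℂ)⁻¹ • x) + (N : ℂ)⁻¹ • x := by
          rw [Nat.cast_succ, add_smul, one_smul]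
        rw [this]
        exact hP_add _ _ ih hN
    have hx : x = (N : ℂ) • ((N : ℂ)⁻¹ • x) := by
      rw [smul_smul, mul_inv_cancel₀ (by exact_mod_cast (by omega : N ≠ 0)), one_smul]
    rw [hx]
    exact hiter N hN1
  -- conclusion by closure induction
  intro γ hγ
  have key : Lift γ := by
    refine Subgroup.closure_induction (p := fun γ _ => Lift γ) ?_ ?_ ?_ ?_ hγ
    · rintro γ ⟨d, e, hde⟩
      have hn1 : 1 ≤ n := by omega
      have hdet_ne : (γ : Matrix (Fin n × Fin n) (Fin n × Fin n) ℂ).det ≠ 0 :=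
        ((Matrix.isUnit_iff_isUnit_det _).1 (Units.isUnit γ)).ne_zero
      rw [hde, Matrix.det_diagonal] at hdet_ne
      have hd : ∀ k, d k ≠ 0 := by
        intro k hk
        refine hdet_ne (Finset.prod_eq_zero (Finset.mem_univ (k, (⟨0, by omega⟩ : Fin n))) ?_)
        simp [hk]
      have he : ∀ l, e l ≠ 0 := by
        intro l hl
        refine hdet_ne (Finset.prod_eq_zero (Finset.mem_univ ((⟨0, by omega⟩ : Fin n), l)) ?_)
        simp [hl]
      have hPx := hP_all (fun k => Complex.log (d k), fun l => Complex.log (e l))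
      rw [hP] at hPx
      refine hPx γ ?_
      rw [hde, htor]
      congr 1; funext p
      simp only [Complex.exp_add, Complex.exp_log (hd _), Complex.exp_log (he _)]
    · rw [hLift]
      exact ⟨1, 1, by simp [Matrix.map_one C C_0 C_1]⟩
    · intro γ δ _ _ hγ hδ
      rw [hLift] at hγ hδ ⊢
      exact rft_lift_mul hγ hδ
    · intro γ _ hγ
      rw [hLift] at hγ ⊢
      exact rft_lift_inv hγ
  rw [hLift] at key
  exact key

end Summit.ValiantsHypothesis.ValiantsHypothesis.Theorems

end
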